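import Summits.ABC.StewartYu.ArchG3LinesAtomsC
import Summits.ABC.StewartYu.ArchG3LinesPathBound
import Summits.ABC.StewartYu.ArchG3LinesV
import Summits.ABC.StewartYu.ArchG3LineSupplyS
import HarnessLib

/-!
# Cell abc-stewartyu, rung A1.L (crux r2 `ArchCoreRat`, stmt-ABC-20502), WP-L.A: the ASSEMBLY of the letter lines (part (C) of
# `stub_recLinesArch`, plan R47): closed record lines `ArchG3Rec.LinesClosedK c` ⇒ the letter-lines supply `ArchG3Line.LinesSupplyS c`

`Summits/ABC/StewartYu/ArchG3LinesAssemblyK.lean` — cell `abc-stewartyu` (HOME `run/shared/lean/pub/abc-stewartyu/`; seat p5 g9).  Theorems only.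
For START outputs with the four shape letters (`ArchG3Line.StartDataS`) the witnesses of `ArchLinesHoldV` are fixed as
`L₀ := P.L₀`, `t := T lev`, `A := AθR`, `V := P.A`, `E := e^G`, `C := CR lev`, `(cl, el) := (1, 0)`, `cb := cbR c lev (Nf lev ν)`
(`cbo := cbR c lev (2Nh lev − 1)`, `cbh := cbR c lev (3Nf lev n + 2)`), `cU := cUR`, `cP := cPR`, `cH := cHR`, and every line of
✓ `KStepLinesV/OddStepLinesV/HalfStepLinesV` at the START's letters is majorised by the corresponding closed line of
`ArchG3Rec.KStepLinesK/OddStepLinesR/HalfStepLinesR` through the θ-side atoms of `ArchG3LinesAtoms(B)`: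

* `SatData.kStepLinesV_of_RK`, `SatData.oddStepLinesV_of_RK`, `SatData.halfStepLinesV_of_RK` — the three converters;
* **`ArchG3Line.linesSupplyS_of_closedK : (∀ n ≥ 2, ∀ P : ArchG3Rec n, P.LinesClosedK (2^(n−1)) c) → LinesSupplyS c`** (the
  adjugate letter `κ = 2^{n−1}` manufactured inside by `SatData.abs_C_le_two_pow`, plan R49) — so that p1's
  `ArchG3Rec.linesClosedK_holds` (record arithmetic, seam (B), n-uniform) closes `stub_recLinesArch` of line `arch-g3-frame`.

WHAT THIS IS NOT: no record inequality (`LinesClosed` is the hypothesis); no crux moves by itself.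

## References
* Yu. V. Nesterenko, LNM 1819 (2003) — §4 Prop. 4.1, §4.2 (4.24)–(4.35), §4.3 (4.36)–(4.51), p. 80–95. [Nesterenko2003]
-/

noncomputable section

open Finset
open scoped Nat Matrix
open Literature.NumberTheory.Transcendental.CW77 (heightProd)
open Summit.ABC.StewartYu.ArchSupply (WC)
open Summit.ABC.StewartYu.ArchG3Par (G G_pos)
open Summit.ABC.StewartYu.ArchG3FrameGlue (setupOf)

namespace Summit.ABC.StewartYu

namespace ArchG3Setup

namespace SatData

variable {S : ArchG3Setup} (F : S.SatData)

/-! ### The three converters -/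

/-- **Closed k-step lines ⇒ the k-step line package at the START's letters.** [cite: Nesterenko2003, §4.2 (4.24)–(4.35); shape only] -/
theorem kStepLinesV_of_RK (κ : ℕ) (htri : ∀ k j : Fin S.n, k < j → F.U k j = 0) (hbox : ∀ k j : Fin S.n, 0 ≤ F.U k j ∧ F.U k j ≤ (F.N : ℤ))
    (hCb : ∀ j k : Fin S.n, |F.C j k| ≤ (κ : ℤ) * F.N) (hlast : ∀ j, j ≤ S.j₀) (P : ArchG3Rec S.n) (hPN : P.N = F.N)
    (hbB : ∀ j, |(F.bo j : ℝ)| * P.A j ≤ P.Bexp * P.A S.j₀) (hbo1 : 1 ≤ |F.bo S.j₀|) {c : ℝ} {lev ν : ℕ}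
    (hR : P.KStepLinesK κ c lev ν) :
    S.KStepLinesV F P.H (P.Sd - lev) P.L₀ (S.Lb (S.sθR F P) lev) (P.wl lev) (P.γb lev) 1 0 (P.δR c) (S.LνR P lev)
      (P.Nf lev ν) (P.Nf lev (ν + 1)) (P.Tf lev ν) (P.Tf lev (ν + 1)) (P.T lev) P.AθR (Real.exp (G S.n)) (P.CRK κ lev) P.A
      P.cUR (P.cPRK κ) (P.cbRK κ c lev (P.Nf lev ν)) (P.cbRK κ c lev (P.Nf lev (ν + 1))) := by
  classical
  obtain ⟨ht, hT, hN', hsm, hJ, hFl, hCl⟩ := hR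
  have hjl := jl_eq P hlast
  have hLb : (S.Lb (S.sθR F P) lev S.j₀ : ℝ) ≤ P.LbRK κ lev P.jl := by
    rw [hjl]; exact_mod_cast F.Lb_le_LbRK κ htri hbox hCb P lev S.j₀
  have hδ0 : 0 ≤ P.δR c := (Real.exp_pos _).le
  have hCR : 0 < P.CRK κ lev := lt_of_lt_of_le one_pos (le_max_left _ _)
  have hyC : (∑ k, P.AθR k * S.GammaC (S.Lb (S.sθR F P) lev) k) / P.CRK κ lev ≤ P.T lev :=
    (div_le_div_of_nonneg_right (F.gammaC_sum_le_yRK κ htri hbox hCb hlast P hPN hbB hbo1 lev) hCR.le).trans (yR_div_CR_leK κ P lev)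
  have hY0 : 0 ≤ S.YC 1 0 (S.Lb (S.sθR F P) lev) := S.YC_nonneg _ _ _
  have hD : ∀ T', Real.log (DΔC (S.YC 1 0 (S.Lb (S.sθR F P) lev)) T') ≤ Real.log (DΔC (P.YRK κ lev) T') :=
    fun T' => log_DΔC_mono T' hY0 (F.YC_le_YRK κ htri hbox hCb hlast P hPN hbB lev)
  have hcD : ∀ (a : ℕ) (x : ℝ), 23 / 20 * a * P.H + 2 * x * (∑ j, ((S.LνR P lev j : ℝ) / F.N) * P.A j) + 2 * ∑ j, P.A j = P.cDR lev a x := by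
    intro a x; unfold ArchG3Rec.cDR ArchG3Rec.SAR
    rw [show (∑ j, ((S.LνR P lev j : ℝ) / F.N) * P.A j) = ∑ j, ((P.LνRR lev j : ℝ) / P.N) * P.A j from
      Finset.sum_congr rfl fun j _ => by rw [LνR_eq_LνRR, hPN]]
  have hsmall : (S.Lb (S.sθR F P) lev S.j₀ : ℝ) * P.δR c * (3 * P.Nf lev ν + 2) ≤ 1 :=
    le_trans (mul_le_mul_of_nonneg_right (mul_le_mul_of_nonneg_right hLb hδ0) (by positivity)) hsm
  refine ⟨ht, hT, hN', Real.one_le_exp (G_pos S.n).le, hsmall, le_max_left _ _, two_mul_le_exp_cbRK κ P c lev _ hLb,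
    two_mul_le_exp_cbRK κ P c lev _ hLb, fun x₁ a hx ha => ?_, fun x₁ a hx ha => ?_, fun x₁ a hx ha => ?_⟩
  · have h := hJ x₁ a hx ha
    linarith [hD (P.Tf lev (ν + 1)), hcD a |(x₁ : ℝ)|]
  · have h := hFl x₁ a hx ha
    rw [Real.log_exp]
    have hρ : 0 ≤ (3 * Real.exp (G S.n) + 1) * (2 * (P.Nf lev ν : ℝ) + 1) + P.Nf lev ν := by positivity
    have hgrow : (P.wl lev + (S.Lb (S.sθR F P) lev S.j₀ : ℝ) * P.δR c) * ((3 * Real.exp (G S.n) + 1) * (2 * (P.Nf lev ν : ℝ) + 1) + P.Nf lev ν) ≤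
        (P.wl lev + (P.LbRK κ lev P.jl : ℝ) * P.δR c) * ((3 * Real.exp (G S.n) + 1) * (2 * (P.Nf lev ν : ℝ) + 1) + P.Nf lev ν) :=
      mul_le_mul_of_nonneg_right (by linarith [mul_le_mul_of_nonneg_right hLb hδ0]) hρ
    linarith [hD (P.Tf lev (ν + 1)), hcD a |(x₁ : ℝ)|]
  · have h := hCl x₁ a hx ha
    linarith [hD (P.Tf lev (ν + 1)), hcD a |(x₁ : ℝ)|]

/-- **Closed odd-node lines ⇒ the odd-node k-step line package at the START's letters.** [cite: Nesterenko2003, §4.2 (𝒳_{s,0}); shape only] -/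
theorem oddStepLinesV_of_RK (κ : ℕ) (htri : ∀ k j : Fin S.n, k < j → F.U k j = 0) (hbox : ∀ k j : Fin S.n, 0 ≤ F.U k j ∧ F.U k j ≤ (F.N : ℤ))
    (hCb : ∀ j k : Fin S.n, |F.C j k| ≤ (κ : ℤ) * F.N) (hlast : ∀ j, j ≤ S.j₀) (P : ArchG3Rec S.n) (hPN : P.N = F.N)
    (hbB : ∀ j, |(F.bo j : ℝ)| * P.A j ≤ P.Bexp * P.A S.j₀) (hbo1 : 1 ≤ |F.bo S.j₀|) {c : ℝ} {lev : ℕ}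
    (hR : P.OddStepLinesK κ c lev) :
    S.OddStepLinesV F P.H (P.Sd - lev) P.L₀ (S.Lb (S.sθR F P) lev) (P.wl lev) (P.γb lev) 1 0 (P.δR c) (S.LνR P lev)
      (P.Nh lev) (P.Nf lev 1) (P.Tf lev 0) (P.Tf lev 1) (P.T lev) P.AθR (Real.exp (G S.n)) (P.CRK κ lev) P.A
      P.cUR (P.cPRK κ) (P.cbRK κ c lev (2 * P.Nh lev - 1)) (P.cbRK κ c lev (P.Nf lev 1)) := by
  classical
  obtain ⟨hm, ht, hT, hN', hsm, hJ, hFl, hCl⟩ := hR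
  have hjl := jl_eq P hlast
  have hLb : (S.Lb (S.sθR F P) lev S.j₀ : ℝ) ≤ P.LbRK κ lev P.jl := by
    rw [hjl]; exact_mod_cast F.Lb_le_LbRK κ htri hbox hCb P lev S.j₀
  have hδ0 : 0 ≤ P.δR c := (Real.exp_pos _).le
  have hCR : 0 < P.CRK κ lev := lt_of_lt_of_le one_pos (le_max_left _ _)
  have hyC : (∑ k, P.AθR k * S.GammaC (S.Lb (S.sθR F P) lev) k) / P.CRK κ lev ≤ P.T lev :=
    (div_le_div_of_nonneg_right (F.gammaC_sum_le_yRK κ htri hbox hCb hlast P hPN hbB hbo1 lev) hCR.le).trans (yR_div_CR_leK κ P lev)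
  have hY0 : 0 ≤ S.YC 1 0 (S.Lb (S.sθR F P) lev) := S.YC_nonneg _ _ _
  have hD : ∀ T', Real.log (DΔC (S.YC 1 0 (S.Lb (S.sθR F P) lev)) T') ≤ Real.log (DΔC (P.YRK κ lev) T') :=
    fun T' => log_DΔC_mono T' hY0 (F.YC_le_YRK κ htri hbox hCb hlast P hPN hbB lev)
  have hcD : ∀ (a : ℕ) (x : ℝ), 23 / 20 * a * P.H + 2 * x * (∑ j, ((S.LνR P lev j : ℝ) / F.N) * P.A j) + 2 * ∑ j, P.A j = P.cDR lev a x := by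
    intro a x; unfold ArchG3Rec.cDR ArchG3Rec.SAR
    rw [show (∑ j, ((S.LνR P lev j : ℝ) / F.N) * P.A j) = ∑ j, ((P.LνRR lev j : ℝ) / P.N) * P.A j from
      Finset.sum_congr rfl fun j _ => by rw [LνR_eq_LνRR, hPN]]
  have hsmall : (S.Lb (S.sθR F P) lev S.j₀ : ℝ) * P.δR c * (6 * P.Nh lev) ≤ 1 :=
    le_trans (mul_le_mul_of_nonneg_right (mul_le_mul_of_nonneg_right hLb hδ0) (by positivity)) hsm
  refine ⟨hm, ht, hT, hN', Real.one_le_exp (G_pos S.n).le, hsmall, le_max_left _ _, two_mul_le_exp_cbRK κ P c lev _ hLb,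
    two_mul_le_exp_cbRK κ P c lev _ hLb, fun x₁ a hx ha => ?_, fun x₁ a hx ha => ?_, fun x₁ a hx ha => ?_⟩
  · have h := hJ x₁ a hx ha
    linarith [hD (P.Tf lev 1), hcD a |(x₁ : ℝ)|]
  · have h := hFl x₁ a hx ha
    rw [Real.log_exp]
    have hρ : 0 ≤ (12 * Real.exp (G S.n) + 6) * (P.Nh lev : ℝ) := by positivity
    have hgrow : (P.wl lev + (S.Lb (S.sθR F P) lev S.j₀ : ℝ) * P.δR c) * ((12 * Real.exp (G S.n) + 6) * (P.Nh lev : ℝ)) ≤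
        (P.wl lev + (P.LbRK κ lev P.jl : ℝ) * P.δR c) * ((12 * Real.exp (G S.n) + 6) * (P.Nh lev : ℝ)) :=
      mul_le_mul_of_nonneg_right (by linarith [mul_le_mul_of_nonneg_right hLb hδ0]) hρ
    linarith [hD (P.Tf lev 1), hcD a |(x₁ : ℝ)|]
  · have h := hCl x₁ a hx ha
    linarith [hD (P.Tf lev 1), hcD a |(x₁ : ℝ)|]

/-- **Closed half-step lines ⇒ the half-step line package at the START's letters** (`ex := Ŝ − (lev+1)`).
[cite: Nesterenko2003, §4.3 (4.36)–(4.51); shape only] -/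
theorem halfStepLinesV_of_RK (κ : ℕ) (htri : ∀ k j : Fin S.n, k < j → F.U k j = 0) (hbox : ∀ k j : Fin S.n, 0 ≤ F.U k j ∧ F.U k j ≤ (F.N : ℤ))
    (hCb : ∀ j k : Fin S.n, |F.C j k| ≤ (κ : ℤ) * F.N) (hlast : ∀ j, j ≤ S.j₀) (P : ArchG3Rec S.n) (hPN : P.N = F.N)
    (hbB : ∀ j, |(F.bo j : ℝ)| * P.A j ≤ P.Bexp * P.A S.j₀) (hbo1 : 1 ≤ |F.bo S.j₀|) {c : ℝ} {lev : ℕ}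
    (hR : P.HalfStepLinesK κ c lev) :
    S.HalfStepLinesV F P.H (P.Sd - (lev + 1)) P.L₀ (S.Lb (S.sθR F P) lev) (P.wl lev) (P.γb lev) 1 0 (P.δR c) (S.LνR P lev)
      (P.Nf lev S.n) (P.Nh (lev + 1)) (P.Tf lev S.n) (P.Tf (lev + 1) 0) (P.T lev) P.AθR (Real.exp (G S.n)) (P.CRK κ lev) P.A
      P.cUR (P.cPRK κ) (P.cbRK κ c lev (P.Nf lev S.n)) (P.cbRK κ c lev (3 * P.Nf lev S.n + 2)) P.cHR := by
  classical
  obtain ⟨ht, hT, hN₁, hsm, hJ, hFl, hCl⟩ := hR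
  have hjl := jl_eq P hlast
  have hH : 1 ≤ P.H := le_max_left _ _
  have hLb : (S.Lb (S.sθR F P) lev S.j₀ : ℝ) ≤ P.LbRK κ lev P.jl := by
    rw [hjl]; exact_mod_cast F.Lb_le_LbRK κ htri hbox hCb P lev S.j₀
  have hδ0 : 0 ≤ P.δR c := (Real.exp_pos _).le
  have hCR : 0 < P.CRK κ lev := lt_of_lt_of_le one_pos (le_max_left _ _)
  have hyC : (∑ k, P.AθR k * S.GammaC (S.Lb (S.sθR F P) lev) k) / P.CRK κ lev ≤ P.T lev :=
    (div_le_div_of_nonneg_right (F.gammaC_sum_le_yRK κ htri hbox hCb hlast P hPN hbB hbo1 lev) hCR.le).trans (yR_div_CR_leK κ P lev)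
  have hY0 : 0 ≤ S.YC 1 0 (S.Lb (S.sθR F P) lev) := S.YC_nonneg _ _ _
  have hD : ∀ T', Real.log (DΔC (S.YC 1 0 (S.Lb (S.sθR F P) lev)) T') ≤ Real.log (DΔC (P.YRK κ lev) T') :=
    fun T' => log_DΔC_mono T' hY0 (F.YC_le_YRK κ htri hbox hCb hlast P hPN hbB lev)
  have hν : ∑ j, ((S.LνR P lev j : ℝ) / F.N) * P.A j = ∑ j, ((P.LνRR lev j : ℝ) / P.N) * P.A j :=
    Finset.sum_congr rfl fun j _ => by rw [LνR_eq_LνRR, hPN]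
  have hcol := F.colU_sum_le hbox P
  have hSA : ∑ j, P.A j = P.SAR := rfl
  have hMt : Real.log (S.MtV P.AθR P.H (P.Sd - (lev + 1)) P.L₀ (P.Tf (lev + 1) 0) (P.Nh (lev + 1)) (P.γb lev + P.wl lev)) =
      Real.log (WC P.H (P.Sd - (lev + 1) + 1) P.L₀ (P.Tf (lev + 1) 0) (P.Nh (lev + 1))) +
        ((P.γb lev + P.wl lev) * P.Nh (lev + 1) + P.AθsumR / 2) := by
    rw [S.log_MtV P.AθR hH]; rfl
  have hsmall : (S.Lb (S.sθR F P) lev S.j₀ : ℝ) * P.δR c * (3 * P.Nf lev S.n + 2) ≤ 1 :=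
    le_trans (mul_le_mul_of_nonneg_right (mul_le_mul_of_nonneg_right hLb hδ0) (by positivity)) hsm
  have h2n : (0 : ℝ) ≤ (2 : ℝ) ^ S.n := by positivity
  -- the threshold: actual ≤ closed, for every `s`, `a`
  have hΘ : ∀ (s : ℤ) (a : ℕ),
      (2 : ℝ) ^ S.n * (Real.log 4 + (23 / 20 * a * P.H + (|(s : ℝ)| * ∑ j, ((S.LνR P lev j : ℝ) / F.N) * P.A j +
          ∑ j, ((F.colU j : ℝ) / F.N) * P.A j + 2 * ∑ j, P.A j)) +
          (Real.log 2 + P.cUR + P.cPRK κ + Real.log (DΔC (S.YC 1 0 (S.Lb (S.sθR F P) lev)) (P.Tf (lev + 1) 0)) +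
            Real.log (S.MtV P.AθR P.H (P.Sd - (lev + 1)) P.L₀ (P.Tf (lev + 1) 0) (P.Nh (lev + 1)) (P.γb lev + P.wl lev))) + 2 * P.cHR) ≤
      (2 : ℝ) ^ S.n * (Real.log 4 + (23 / 20 * a * P.H + (|(s : ℝ)| * ∑ j, ((P.LνRR lev j : ℝ) / P.N) * P.A j + S.n * P.SAR + 2 * P.SAR)) +
        (Real.log 2 + P.cUR + P.cPRK κ + Real.log (DΔC (P.YRK κ lev) (P.Tf (lev + 1) 0)) +
          (Real.log (WC P.H (P.Sd - (lev + 1) + 1) P.L₀ (P.Tf (lev + 1) 0) (P.Nh (lev + 1))) + (P.γb lev + P.wl lev) * P.Nh (lev + 1) +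
            P.AθsumR / 2)) + 2 * P.cHR) := by
    intro s a
    refine mul_le_mul_of_nonneg_left ?_ h2n
    rw [hν, hMt, hSA]
    linarith [hD (P.Tf (lev + 1) 0)]
  refine ⟨ht, hT, hN₁, Real.one_le_exp (G_pos S.n).le, hsmall, le_max_left _ _, two_mul_le_exp_cbRK κ P c lev _ hLb, ?_,
    fun s a hs hsb ha => ?_, fun s a hs hsb ha => ?_, fun s a hs hsb ha => ?_⟩
  · have h := two_mul_le_exp_cbRK κ P c lev (3 * P.Nf lev S.n + 2) hLb
    push_cast at h ⊢
    linarith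
  · have h := hJ s a hs hsb ha
    linarith [hD (P.Tf (lev + 1) 0), hΘ s a]
  · have h := hFl s a hs hsb ha
    rw [Real.log_exp]
    have hρ : 0 ≤ (3 * Real.exp (G S.n) + 1) * (2 * (P.Nf lev S.n : ℝ) + 1) + P.Nf lev S.n := by positivity
    have hgrow : (P.wl lev + (S.Lb (S.sθR F P) lev S.j₀ : ℝ) * P.δR c) * ((3 * Real.exp (G S.n) + 1) * (2 * (P.Nf lev S.n : ℝ) + 1) + P.Nf lev S.n) ≤
        (P.wl lev + (P.LbRK κ lev P.jl : ℝ) * P.δR c) * ((3 * Real.exp (G S.n) + 1) * (2 * (P.Nf lev S.n : ℝ) + 1) + P.Nf lev S.n) :=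
      mul_le_mul_of_nonneg_right (by linarith [mul_le_mul_of_nonneg_right hLb hδ0]) hρ
    linarith [hD (P.Tf (lev + 1) 0), hΘ s a]
  · have h := hCl s a hs hsb ha
    linarith [hD (P.Tf (lev + 1) 0), hΘ s a]

end SatData

end ArchG3Setup

/-! ### The letter-lines supply from the closed lines -/

namespace ArchG3Line

/-- **`LinesClosed` at every record ⇒ `LinesSupplyS`** (part (C) of `stub_recLinesArch`): direction schedule `(cl, el) := (1, 0)` (the zero FUNCTION, so that `el lev` is
literally `0`); witnesses
`L₀, T, AθR, A, e^G, CR, cbR, cUR, cPR, cHR`; the globals from the START's count/degree bounds and the datum's weight lines; the four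
families from the three converters. [cite: Nesterenko2003, §4 Prop. 4.1, §4.2–4.3, p. 80–95] -/
theorem linesSupplyS_of_closedK {c : ℝ} (hcl : ∀ n, 2 ≤ n → ∀ P : ArchG3Rec n, P.LinesClosedK (2 ^ (n - 1)) c) : LinesSupplyS c := by
  classical
  intro n hn a b A B k₀ ha hind hA hA1 hbz hgcd hmono hmax hBw hneg hreg θ hθ bt jt hjt F P hαo hbo hPA hPN hdet hPW htri hbox _hCb hlast
    _hnsq
  refine ⟨fun _ => 1, fun _ => (0 : Fin n → ℤ), one_ne_zero, rfl, fun 𝔏 hdeg hcount hU1 => ?_⟩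
  obtain ⟨hK0, hHf, hO, hK⟩ := hcl n hn P
  -- the n-uniform adjugate letter (path bound)
  have hCb : ∀ j k : Fin n, |F.C j k| ≤ ((2 ^ (n - 1) : ℕ) : ℤ) * F.N := fun j k => F.abs_C_le_two_pow htri hbox hdet j k
  -- datum facts at the START's letters
  have hAk₀ : A jt = A k₀ := le_antisymm (hmax jt) (hmono (hlast k₀))
  have hB1 : 1 ≤ B := by
    have h1 := hBw k₀
    have hb1 : (1 : ℝ) ≤ |(b k₀ : ℝ)| := by exact_mod_cast Int.one_le_abs (hbz k₀)
    have hA0 : 0 < A k₀ := lt_of_lt_of_le one_pos (hA1 k₀)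
    nlinarith
  have hBexp : P.Bexp = B := by
    unfold ArchG3Rec.Bexp
    rw [hPW, Real.log_mul (Real.exp_pos 1).ne' (by linarith), Real.log_exp, add_sub_cancel_left, Real.exp_log (by linarith)]
  have hbB : ∀ j, |(F.bo j : ℝ)| * P.A j ≤ P.Bexp * P.A jt := by
    intro j; rw [hbo, hPA, hBexp, hAk₀]; exact hBw j
  have hbo1 : 1 ≤ |F.bo jt| := by rw [hbo]; exact Int.one_le_abs (hbz jt)
  have hAo : ∀ j, |Real.log (F.αo j : ℝ)| ≤ P.A j := fun j => by
    rw [hαo, hPA]; exact GenThreeBaseArch.abs_log_le_weight (ha j) (hA j)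
  have hV : ∀ j, Height.logHeight₁ (F.αo j) ≤ P.A j := fun j => by rw [hαo, hPA]; exact hA j
  have hδ : Real.exp (-(c ^ n * P.Ω * P.W)) = P.δR c := rfl
  have hP1 : (1 : ℤ) ≤ ⌈(((setupOf n θ hθ bt jt hjt).unkA P.L₀ 𝔏).card : ℝ) * (setupOf n θ hθ bt jt hjt).AmaxR F P 1 0⌉ := by
    have hA1' : 1 ≤ (setupOf n θ hθ bt jt hjt).AmaxR F P 1 0 := le_max_left _ _
    have hU1' : (1 : ℝ) ≤ ((setupOf n θ hθ bt jt hjt).unkA P.L₀ 𝔏).card := by exact_mod_cast hU1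
    exact Int.one_le_ceil_iff.mpr (lt_of_lt_of_le one_pos (one_le_mul_of_one_le_of_one_le hU1' hA1'))
  rw [hδ]
  beta_reduce
  -- the witnesses
  refine ⟨P.L₀, fun lev _ => P.T lev, P.AθR, P.A, fun _ _ => Real.exp (G n), fun lev _ => P.CRK (2 ^ (n - 1)) lev,
    fun lev ν => P.cbRK (2 ^ (n - 1)) c lev (P.Nf lev ν), fun lev => P.cbRK (2 ^ (n - 1)) c lev (2 * P.Nh lev - 1),
    fun lev => P.cbRK (2 ^ (n - 1)) c lev (3 * P.Nf lev n + 2), P.cUR, P.cPRK (2 ^ (n - 1)), P.cHR, ?_⟩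
  refine ⟨le_max_left _ _, hdeg, hU1, hP1, (Real.exp_pos _).le, fun lev => (P.wl_facts lev).2.le, fun lev => (P.γb_facts lev).2.2.2.le,
    fun _ => one_ne_zero, fun k => F.abs_lg_le htri hbox hAo k, hV,
    ArchG3Setup.SatData.card_le_exp_cUR (S := setupOf n θ hθ bt jt hjt) P hcount,
    F.ceil_le_exp_cPRK (2 ^ (n - 1)) htri hbox hCb hlast P hPN hbB hV hcount hU1, F.log_heightProd_le_cHR hbox P hV,
    fun ν hν => ?_, fun lev hlev => ?_, fun lev hlev => ?_, fun lev hlev ν hν1 hν => ?_⟩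
  · exact F.kStepLinesV_of_RK (2 ^ (n - 1)) htri hbox hCb hlast P hPN hbB hbo1 (hK0 ν hν)
  · exact F.halfStepLinesV_of_RK (2 ^ (n - 1)) htri hbox hCb hlast P hPN hbB hbo1 (hHf lev hlev)
  · exact F.oddStepLinesV_of_RK (2 ^ (n - 1)) htri hbox hCb hlast P hPN hbB hbo1 (hO lev hlev)
  · exact F.kStepLinesV_of_RK (2 ^ (n - 1)) htri hbox hCb hlast P hPN hbB hbo1 (hK lev hlev ν hν1 hν)


/-- **`LinesClosedK` at every record WITH SORTED WEIGHTS ⇒ `LinesSupplyS`**: the same assembly, for a record-side theorem that takes the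
sorted-weights letter `Monotone P.A` (p1's `ArchG3RecLinesD`: the jets radius `CR` needs it) — discharged here from the datum's `Monotone A`
and `P.A = A`. [cite: Nesterenko2003, §4 Prop. 4.1, §4.2–4.3, p. 80–95] -/
theorem linesSupplyS_of_closedK_mono {c : ℝ}
    (hcl : ∀ n, 2 ≤ n → ∀ P : ArchG3Rec n, Monotone P.A → P.LinesClosedK (2 ^ (n - 1)) c) : LinesSupplyS c := by
  classical
  intro n hn a b A B k₀ ha hind hA hA1 hbz hgcd hmono hmax hBw hneg hreg θ hθ bt jt hjt F P hαo hbo hPA hPN hdet hPW htri hbox _hCb hlast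
    _hnsq
  refine ⟨fun _ => 1, fun _ => (0 : Fin n → ℤ), one_ne_zero, rfl, fun 𝔏 hdeg hcount hU1 => ?_⟩
  have hmonoP : Monotone P.A := by rw [hPA]; exact hmono
  obtain ⟨hK0, hHf, hO, hK⟩ := hcl n hn P hmonoP
  -- the n-uniform adjugate letter (path bound)
  have hCb : ∀ j k : Fin n, |F.C j k| ≤ ((2 ^ (n - 1) : ℕ) : ℤ) * F.N := fun j k => F.abs_C_le_two_pow htri hbox hdet j k
  -- datum facts at the START's letters
  have hAk₀ : A jt = A k₀ := le_antisymm (hmax jt) (hmono (hlast k₀))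
  have hB1 : 1 ≤ B := by
    have h1 := hBw k₀
    have hb1 : (1 : ℝ) ≤ |(b k₀ : ℝ)| := by exact_mod_cast Int.one_le_abs (hbz k₀)
    have hA0 : 0 < A k₀ := lt_of_lt_of_le one_pos (hA1 k₀)
    nlinarith
  have hBexp : P.Bexp = B := by
    unfold ArchG3Rec.Bexp
    rw [hPW, Real.log_mul (Real.exp_pos 1).ne' (by linarith), Real.log_exp, add_sub_cancel_left, Real.exp_log (by linarith)]
  have hbB : ∀ j, |(F.bo j : ℝ)| * P.A j ≤ P.Bexp * P.A jt := by
    intro j; rw [hbo, hPA, hBexp, hAk₀]; exact hBw j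
  have hbo1 : 1 ≤ |F.bo jt| := by rw [hbo]; exact Int.one_le_abs (hbz jt)
  have hAo : ∀ j, |Real.log (F.αo j : ℝ)| ≤ P.A j := fun j => by
    rw [hαo, hPA]; exact GenThreeBaseArch.abs_log_le_weight (ha j) (hA j)
  have hV : ∀ j, Height.logHeight₁ (F.αo j) ≤ P.A j := fun j => by rw [hαo, hPA]; exact hA j
  have hδ : Real.exp (-(c ^ n * P.Ω * P.W)) = P.δR c := rfl
  have hP1 : (1 : ℤ) ≤ ⌈(((setupOf n θ hθ bt jt hjt).unkA P.L₀ 𝔏).card : ℝ) * (setupOf n θ hθ bt jt hjt).AmaxR F P 1 0⌉ := by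
    have hA1' : 1 ≤ (setupOf n θ hθ bt jt hjt).AmaxR F P 1 0 := le_max_left _ _
    have hU1' : (1 : ℝ) ≤ ((setupOf n θ hθ bt jt hjt).unkA P.L₀ 𝔏).card := by exact_mod_cast hU1
    exact Int.one_le_ceil_iff.mpr (lt_of_lt_of_le one_pos (one_le_mul_of_one_le_of_one_le hU1' hA1'))
  rw [hδ]
  beta_reduce
  -- the witnesses
  refine ⟨P.L₀, fun lev _ => P.T lev, P.AθR, P.A, fun _ _ => Real.exp (G n), fun lev _ => P.CRK (2 ^ (n - 1)) lev,
    fun lev ν => P.cbRK (2 ^ (n - 1)) c lev (P.Nf lev ν), fun lev => P.cbRK (2 ^ (n - 1)) c lev (2 * P.Nh lev - 1),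
    fun lev => P.cbRK (2 ^ (n - 1)) c lev (3 * P.Nf lev n + 2), P.cUR, P.cPRK (2 ^ (n - 1)), P.cHR, ?_⟩
  refine ⟨le_max_left _ _, hdeg, hU1, hP1, (Real.exp_pos _).le, fun lev => (P.wl_facts lev).2.le, fun lev => (P.γb_facts lev).2.2.2.le,
    fun _ => one_ne_zero, fun k => F.abs_lg_le htri hbox hAo k, hV,
    ArchG3Setup.SatData.card_le_exp_cUR (S := setupOf n θ hθ bt jt hjt) P hcount,
    F.ceil_le_exp_cPRK (2 ^ (n - 1)) htri hbox hCb hlast P hPN hbB hV hcount hU1, F.log_heightProd_le_cHR hbox P hV,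
    fun ν hν => ?_, fun lev hlev => ?_, fun lev hlev => ?_, fun lev hlev ν hν1 hν => ?_⟩
  · exact F.kStepLinesV_of_RK (2 ^ (n - 1)) htri hbox hCb hlast P hPN hbB hbo1 (hK0 ν hν)
  · exact F.halfStepLinesV_of_RK (2 ^ (n - 1)) htri hbox hCb hlast P hPN hbB hbo1 (hHf lev hlev)
  · exact F.oddStepLinesV_of_RK (2 ^ (n - 1)) htri hbox hCb hlast P hPN hbB hbo1 (hO lev hlev)
  · exact F.kStepLinesV_of_RK (2 ^ (n - 1)) htri hbox hCb hlast P hPN hbB hbo1 (hK lev hlev ν hν1 hν)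


end ArchG3Line

end Summit.ABC.StewartYu

end
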